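import Summits.BirchSwinnertonDyer.BirchSwinnertonDyer.Theorems.Rank2Observatory2DescKillCheck
import HarnessLib

/-!
# BirchSwinnertonDyer — rank ≥ 2 observatory: KERNEL-2DESC kill layer — SPLIT kill certificates (survivor lists)

HONEST FRAMING: per-curve certified theorems and census instruments; no claim on BSD in rank ≥ 2.

The residue-insolubility search `TwoDescKill.killCheck p a b c z t₁ t₂ fuel` (`Rank2Observatory2DescKillCheck`)
of a killed class is normally evaluated inside ONE `decide +kernel` call.  The kernel evaluator caches every
subterm, so a search tree with more than ≈ 18 000 nodes exhausts the kernel's memory budget ("(kernel) excessive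
memory consumption detected") although the certificate is true.  This module — a free-standing copy, in its own
namespace `TwoDescKillSplit`, of the survivor-list mechanism of the (per-format) v2.6 row layer, importing only the
integer half of the kill layer — splits the SAME certificate into independently decided pieces, reusable by
every row format (PID, class-group-general, two-view):

* `KNode = (g, i, v, M)` — an internal node of the search tree (remaining fuel `g ≥ 1`, chart `i`, vector `v`,
  modulus `M`); `nodeOK … S n` — every one of the `p³` children of `n` is dead (`killQ ≢ 0 mod M·p`) or is itself
  listed in `S` with fuel `g − 1`; `rootOK … S fuel` — every chart-normalised start vector is dead mod `p` or
  listed with fuel `fuel`;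
* `killCheck_of_chunks` — `rootOK` and `nodeOK` for every listed node (supplied chunk by chunk as a chain
  `chunks_cons (by decide +kernel) … chunks_nil`, one kernel call per chunk) imply `killCheck p … fuel = true`
  (strong induction on the remaining fuel; a dead node passes `check` at any fuel).

Nothing here is specific to a rank, a field or a row format.  The survivor lists are produced by an emitter's exact
mirror of `check` (second implementation) and re-verified by it before a row is written.  New declarations only;
sorry-free; no new axioms. [cite: CremonaAlgorithms1997, §3.6] [cite: Cassels1991LecturesEllipticCurves, §15]
-/

set_option linter.dupNamespace false

namespace Summit.BirchSwinnertonDyer.BirchSwinnertonDyer.Rank2Observatory.TwoDescKillSplit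

open TwoDescKill

/-! ## Survivor-list form of the residue search -/

/-- An internal node of the `killCheck` search tree: remaining fuel `g`, chart `i`, vector `v`,
modulus `M`. [folklore] -/
abbrev KNode := ℕ × ℕ × (ℤ × ℤ × ℤ × ℤ) × ℕ

/-- Node certificate: `g ≥ 1` and each of the `p³` children `addDigits i v M d` is dead modulo `M·p`
or listed in `S` with fuel `g − 1` (same child expressions as `check`). [cite: CremonaAlgorithms1997, §3.6] -/
def nodeOK (p : ℕ) (a b c : ℤ) (z : ℤ × ℤ × ℤ) (t₁ t₂ : ℤ) (S : List KNode) (n : KNode) : Bool :=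
  decide (1 ≤ n.1) &&
    ((List.range p).all fun d₀ => (List.range p).all fun d₁ => (List.range p).all fun d₂ =>
      dead (n.2.2.2 * p) (killQ a b c z t₁ t₂ (addDigits n.2.1 n.2.2.1 n.2.2.2 d₀ d₁ d₂)) ||
        decide ((n.1 - 1, n.2.1, addDigits n.2.1 n.2.2.1 n.2.2.2 d₀ d₁ d₂, n.2.2.2 * p) ∈ S))

/-- Root certificate: every chart-normalised start vector of `killCheck` is dead modulo `p` or listed
in `S` with fuel `fuel`. [cite: CremonaAlgorithms1997, §3.6] -/
def rootOK (p : ℕ) (a b c : ℤ) (z : ℤ × ℤ × ℤ) (t₁ t₂ : ℤ) (S : List KNode) (fuel : ℕ) : Bool :=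
  ((List.range p).all fun d₀ => (List.range p).all fun d₁ => (List.range p).all fun d₂ =>
      dead p (killQ a b c z t₁ t₂ (1, (d₀ : ℤ), (d₁ : ℤ), (d₂ : ℤ))) ||
        decide ((fuel, 0, ((1 : ℤ), (d₀ : ℤ), (d₁ : ℤ), (d₂ : ℤ)), p) ∈ S)) &&
  ((List.range p).all fun d₁ => (List.range p).all fun d₂ =>
      dead p (killQ a b c z t₁ t₂ (0, 1, (d₁ : ℤ), (d₂ : ℤ))) ||
        decide ((fuel, 1, ((0 : ℤ), (1 : ℤ), (d₁ : ℤ), (d₂ : ℤ)), p) ∈ S)) &&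
  ((List.range p).all fun d₂ =>
      dead p (killQ a b c z t₁ t₂ (0, 0, 1, (d₂ : ℤ))) ||
        decide ((fuel, 2, ((0 : ℤ), (0 : ℤ), (1 : ℤ), (d₂ : ℤ)), p) ∈ S)) &&
  (dead p (killQ a b c z t₁ t₂ (0, 0, 0, 1)) ||
    decide ((fuel, 3, ((0 : ℤ), (0 : ℤ), (0 : ℤ), (1 : ℤ)), p) ∈ S))

variable {p : ℕ} {a b c : ℤ} {z : ℤ × ℤ × ℤ} {t₁ t₂ : ℤ}

/-- No chunks: nothing to certify (the tail of a row's chunk chain). [folklore] -/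
theorem chunks_nil {S : List KNode} :
    ∀ C ∈ ([] : List (List KNode)), (C.all (nodeOK p a b c z t₁ t₂ S)) = true := by simp

/-- Prepend one decided chunk (each `h₁` is its own `decide +kernel`, hence its own kernel call). [folklore] -/
theorem chunks_cons {S : List KNode} {C : List KNode} {rest : List (List KNode)}
    (h₁ : (C.all (nodeOK p a b c z t₁ t₂ S)) = true)
    (h : ∀ C' ∈ rest, (C'.all (nodeOK p a b c z t₁ t₂ S)) = true) :
    ∀ C' ∈ C :: rest, (C'.all (nodeOK p a b c z t₁ t₂ S)) = true :=
  List.forall_mem_cons.mpr ⟨h₁, h⟩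

/-- Every node of a certified chunk list passes `nodeOK`. [folklore] -/
theorem forall_mem_flatten_of_chunks {S : List KNode} {SS : List (List KNode)}
    (h : ∀ C ∈ SS, (C.all (nodeOK p a b c z t₁ t₂ S)) = true) :
    ∀ n ∈ SS.flatten, nodeOK p a b c z t₁ t₂ S n = true := by
  intro n hn
  obtain ⟨C, hC, hn'⟩ := List.mem_flatten.mp hn
  exact List.all_eq_true.mp (h C hC) n hn'

/-- A dead node passes `check` at any fuel. [folklore] -/
theorem check_of_dead {v : ℤ × ℤ × ℤ × ℤ} {i M : ℕ} (h : dead M (killQ a b c z t₁ t₂ v) = true)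
    (f : ℕ) : check p a b c z t₁ t₂ f v i M = true := by
  cases f <;> simp [check, h]

/-- Every listed node passes `check` with its own fuel (strong induction on the fuel: the children are
dead — `check_of_dead` — or listed with one less fuel). [cite: CremonaAlgorithms1997, §3.6] -/
theorem check_of_mem {S : List KNode} (hS : ∀ n ∈ S, nodeOK p a b c z t₁ t₂ S n = true) :
    ∀ (g : ℕ) (n : KNode), n ∈ S → n.1 = g → check p a b c z t₁ t₂ g n.2.2.1 n.2.1 n.2.2.2 = true := by
  intro g
  induction g using Nat.strong_induction_on with
  | _ g ih =>
    intro n hn hg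
    have h := hS n hn
    obtain ⟨gn, i, v, M⟩ := n
    simp only [nodeOK, Bool.and_eq_true, decide_eq_true_eq, List.all_eq_true, List.mem_range,
      Bool.or_eq_true] at h
    obtain ⟨h1, hall⟩ := h
    simp only at hg
    subst hg
    obtain ⟨g', rfl⟩ : ∃ g', gn = g' + 1 := ⟨gn - 1, by omega⟩
    show check p a b c z t₁ t₂ (g' + 1) v i M = true
    simp only [check, Bool.or_eq_true, List.all_eq_true, List.mem_range]
    right
    intro d₀ hd₀ d₁ hd₁ d₂ hd₂
    rcases hall d₀ hd₀ d₁ hd₁ d₂ hd₂ with hdead | hmem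
    · exact check_of_dead hdead g'
    · have := ih g' (by omega) _ hmem (by simp)
      simpa using this

/-- **Split kill certificate**: the root certificate and the node certificates of a chunked survivor
list imply the monolithic `killCheck`. [cite: CremonaAlgorithms1997, §3.6] -/
theorem killCheck_of_chunks {fuel : ℕ} (SS : List (List KNode))
    (hroot : rootOK p a b c z t₁ t₂ SS.flatten fuel = true)
    (h : ∀ C ∈ SS, (C.all (nodeOK p a b c z t₁ t₂ SS.flatten)) = true) :
    killCheck p a b c z t₁ t₂ fuel = true := by
  have hm := check_of_mem (forall_mem_flatten_of_chunks h) fuel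
  simp only [rootOK, Bool.and_eq_true, List.all_eq_true, List.mem_range, Bool.or_eq_true,
    decide_eq_true_eq] at hroot
  obtain ⟨⟨⟨h0, h1⟩, h2⟩, h3⟩ := hroot
  simp only [killCheck, Bool.and_eq_true, List.all_eq_true, List.mem_range]
  refine ⟨⟨⟨fun d₀ hd₀ d₁ hd₁ d₂ hd₂ => ?_, fun d₁ hd₁ d₂ hd₂ => ?_⟩, fun d₂ hd₂ => ?_⟩, ?_⟩
  · rcases h0 d₀ hd₀ d₁ hd₁ d₂ hd₂ with hd | hmem
    · exact check_of_dead hd fuel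
    · simpa using hm _ hmem rfl
  · rcases h1 d₁ hd₁ d₂ hd₂ with hd | hmem
    · exact check_of_dead hd fuel
    · simpa using hm _ hmem rfl
  · rcases h2 d₂ hd₂ with hd | hmem
    · exact check_of_dead hd fuel
    · simpa using hm _ hmem rfl
  · rcases h3 with hd | hmem
    · exact check_of_dead hd fuel
    · simpa using hm _ hmem rfl

/-! ## Kernel sanity checks (cubic `X³ + 4X − 1` of discriminant `−283`, `z = (−3, −2, 2)`, `(t₁, t₂) = (1, 0)`, `p = 2`) -/

/-- A genuine depth-2 certificate, split into two chunks (three surviving nodes) … -/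
example : killCheck 2 0 4 (-1) (-3, -2, 2) 1 0 1 = true :=
  killCheck_of_chunks [[(1, 0, (1, 0, 0, 0), 2), (1, 0, (1, 0, 1, 1), 2)], [(1, 2, (0, 0, 1, 1), 2)]]
    (by decide +kernel) (chunks_cons (by decide +kernel) (chunks_cons (by decide +kernel) chunks_nil))

/-- … in agreement with the monolithic evaluation; … -/
example : killCheck 2 0 4 (-1) (-3, -2, 2) 1 0 1 = true := by decide +kernel

/-- … one level less is not a certificate, … -/
example : killCheck 2 0 4 (-1) (-3, -2, 2) 1 0 0 = false := by decide +kernel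

/-- … and the root certificate fails when a surviving node is not listed. -/
example : rootOK 2 0 4 (-1) (-3, -2, 2) 1 0 [(1, 0, (1, 0, 0, 0), 2), (1, 2, (0, 0, 1, 1), 2)] 1 = false := by
  decide +kernel

end Summit.BirchSwinnertonDyer.BirchSwinnertonDyer.Rank2Observatory.TwoDescKillSplit
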